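import Summits.Ventures.Crystal3D.Bulk.RotSysInduce
import Mathlib.Logic.Relation
import HarnessLib

/-!
# Rotation systems on a subset of darts: the face permutation, and the counts `V, E, F, k`
# (generic brick (G1b) of `phase2/LEAN-FACES-DESIGN.md` §5.3 (G1))

HONEST FRAMING. Part of the venture `Summits/Ventures/Crystal3D` (cell `pub-crystal3d`, phase 2;
seat typer-bulk-2), PURELY COMBINATORIAL and generic (folklore): no geometry. A loopless
ROTATION SYSTEM on a finite dart type `D` is a rotation `σ : Perm D` and a fixed-point-free
involution `α : Perm D` (the two darts of an edge) such that no edge has both darts at the same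
vertex (`IsRotSys`). For an `α`-closed subset `S` of darts (a spanning sub-graph with the INDUCED
rotation `induce σ S` of `Bulk/RotSysInduce.lean`) this file defines

* `numClasses R S` — the number of classes of a relation on a finset, with
  `numClasses_le_card`, `filter_eq_filter_of_rel`, and **`numClasses_le_of_imp`** (a coarser
  equivalence has at most as many classes);
* the face permutation `phi σ α S = induce σ S * α` (`φ_S = σ_S ∘ α`), `phi_apply_mem_iff`,
  `IsRotSys.phi_ne_self` (no face of length `1`);
* the counts `numV σ S` (vertices = `σ`-cycles meeting `S`), `numF σ α S` (faces = cycles of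
  `φ_S` on `S`), the connectivity relation `conn σ α S` (equivalence closure on `S` of "same vertex
  or opposite darts") with `numK σ α S` components, and `chi2 σ α S = 2·numV − #S + 2·numF`
  (twice the Euler characteristic, `#S = 2E`); `conn_phi` / `conn_of_sameCycle_phi` (a face lies
  in one component), `numK_le_numF`, `numK_le_numV`.

TARGET for successors (NOT proved here; (G1) of the design note): for an `α`-closed `S` and an
edge `e = {d, α d} ⊆ S`, `chi2 (S \ e) − 4·numK (S \ e) ≥ chi2 S − 4·numK S`; hence
`chi2 S ≤ 4·numK S` for every `S`, and `chi2 S = 4·numK S` for every `α`-closed `S` once it holds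
for the ambient dart set (sub-rotation-systems of planar maps are planar). Nothing here mentions
GAP(1.26).
-/

namespace Summit.Ventures.Crystal3D

namespace RotSys

open Equiv Equiv.Perm Finset

variable {D : Type*} [DecidableEq D]

/-! ## Counting the classes of a relation on a finset -/

section Classes

open scoped Classical

/-- **The number of classes** of the relation `R` on the finset `S`: the number of distinct sets
`{y ∈ S | R x y}`, `x ∈ S` (for `R` an equivalence relation on `S`, the number of equivalence
classes). -/
noncomputable def numClasses (R : D → D → Prop) (S : Finset D) : ℕ :=
  (S.image fun x => S.filter fun y => R x y).card

/-- At most `#S` classes. -/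
theorem numClasses_le_card (R : D → D → Prop) (S : Finset D) : numClasses R S ≤ S.card := by
  unfold numClasses
  exact Finset.card_image_le

/-- No classes on the empty set. -/
theorem numClasses_empty (R : D → D → Prop) : numClasses R (∅ : Finset D) = 0 := by
  unfold numClasses
  simp

/-- A nonempty set has a class. -/
theorem numClasses_pos (R : D → D → Prop) {S : Finset D} (hS : S.Nonempty) : 0 < numClasses R S := by
  unfold numClasses
  exact Finset.card_pos.2 (hS.image _)

omit [DecidableEq D] in
/-- **Related points have the same class** (for `R` symmetric and transitive on `S`). -/
theorem filter_eq_filter_of_rel {R : D → D → Prop} {S : Finset D}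
    (hsymm : ∀ x ∈ S, ∀ y ∈ S, R x y → R y x)
    (htrans : ∀ x ∈ S, ∀ y ∈ S, ∀ z ∈ S, R x y → R y z → R x z)
    {x y : D} (hx : x ∈ S) (hy : y ∈ S) (hxy : R x y) :
    (S.filter fun z => R x z) = S.filter fun z => R y z := by
  ext z
  simp only [Finset.mem_filter]
  constructor
  · rintro ⟨hz, hxz⟩
    exact ⟨hz, htrans y hy x hx z hz (hsymm x hx y hy hxy) hxz⟩
  · rintro ⟨hz, hyz⟩
    exact ⟨hz, htrans x hx y hy z hz hxy hyz⟩

/-- **A coarser equivalence has at most as many classes.** If `R` is reflexive on `S`, `R'` is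
symmetric and transitive on `S`, and `R x y → R' x y` on `S`, then
`numClasses R' S ≤ numClasses R S`. -/
theorem numClasses_le_of_imp {R R' : D → D → Prop} {S : Finset D}
    (hrefl : ∀ x ∈ S, R x x)
    (hsymm : ∀ x ∈ S, ∀ y ∈ S, R' x y → R' y x)
    (htrans : ∀ x ∈ S, ∀ y ∈ S, ∀ z ∈ S, R' x y → R' y z → R' x z)
    (himp : ∀ x ∈ S, ∀ y ∈ S, R x y → R' x y) :
    numClasses R' S ≤ numClasses R S := by
  unfold numClasses
  -- the map "class of `x` for `R`" ↦ "class of `x` for `R'`" is well defined and onto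
  refine Finset.card_le_card_of_surjOn
    (fun C => if h : ∃ x ∈ S, (S.filter fun y => R x y) = C
      then S.filter fun y => R' (Classical.choose h) y else ∅) ?_
  intro C' hC'
  rw [Finset.mem_coe, Finset.mem_image] at hC'
  obtain ⟨y, hy, rfl⟩ := hC'
  refine ⟨S.filter fun z => R y z, ?_, ?_⟩
  · rw [Finset.mem_coe, Finset.mem_image]
    exact ⟨y, hy, rfl⟩
  · have h : ∃ x ∈ S, (S.filter fun z => R x z) = S.filter fun z => R y z := ⟨y, hy, rfl⟩
    simp only [dif_pos h]
    obtain ⟨hx, heq⟩ := Classical.choose_spec h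
    -- `y` is in the `R`-class of the chosen `x`, so `R x y`, so `R' x y`
    have hyx : y ∈ S.filter fun z => R (Classical.choose h) z := by
      rw [heq]; exact Finset.mem_filter.2 ⟨hy, hrefl y hy⟩
    exact filter_eq_filter_of_rel hsymm htrans hx hy
      (himp _ hx _ hy (Finset.mem_filter.1 hyx).2)

end Classes

/-! ## Loopless rotation systems -/

omit [DecidableEq D] in
/-- **A loopless rotation system**: `α` is a fixed-point-free involution (the two darts of each
edge) and no edge is a loop (its two darts lie at different vertices = `σ`-cycles). -/
structure IsRotSys (σ α : Perm D) : Prop where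
  /-- `α` is an involution -/
  α_inv : ∀ x, α (α x) = x
  /-- `α` has no fixed point -/
  α_ne : ∀ x, α x ≠ x
  /-- no loops: the two darts of an edge are at different vertices -/
  loopless : ∀ x, ¬ σ.SameCycle x (α x)

omit [DecidableEq D] in
/-- A dart subset is `α`-CLOSED if it contains, with a dart, the opposite dart (it is a union of
edges). -/
def IsClosed (α : Perm D) (S : Finset D) : Prop :=
  ∀ x ∈ S, α x ∈ S

/-- **Vertices of `S`**: the `σ`-cycles (vertices of the ambient map) containing a dart of `S`. -/
noncomputable def numV (σ : Perm D) (S : Finset D) : ℕ :=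
  numClasses (fun x y => σ.SameCycle x y) S

/-- The vertex count is at most the number of darts. -/
theorem numV_le_card (σ : Perm D) (S : Finset D) : numV σ S ≤ S.card :=
  numClasses_le_card _ _

omit [DecidableEq D] in
/-- The elementary adjacency on `S`: same vertex, or the two darts of an edge. -/
def adj (σ α : Perm D) (S : Finset D) (x y : D) : Prop :=
  x ∈ S ∧ y ∈ S ∧ (σ.SameCycle x y ∨ y = α x)

omit [DecidableEq D] in
/-- **Connectivity** in `S`: the equivalence closure of `adj`. -/
def conn (σ α : Perm D) (S : Finset D) : D → D → Prop :=
  Relation.EqvGen (adj σ α S)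

/-- **Connected components of `S`**. -/
noncomputable def numK (σ α : Perm D) (S : Finset D) : ℕ :=
  numClasses (conn σ α S) S

/-- No components on the empty dart set. -/
theorem numK_empty (σ α : Perm D) : numK σ α (∅ : Finset D) = 0 :=
  numClasses_empty _

omit [DecidableEq D] in
/-- `conn` is reflexive. -/
theorem conn_refl (σ α : Perm D) (S : Finset D) (x : D) : conn σ α S x x :=
  Relation.EqvGen.refl x

omit [DecidableEq D] in
/-- `conn` is symmetric. -/
theorem conn_symm {σ α : Perm D} {S : Finset D} {x y : D} (h : conn σ α S x y) : conn σ α S y x :=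
  Relation.EqvGen.symm x y h

omit [DecidableEq D] in
/-- `conn` is transitive. -/
theorem conn_trans {σ α : Perm D} {S : Finset D} {x y z : D} (h1 : conn σ α S x y)
    (h2 : conn σ α S y z) : conn σ α S x z :=
  Relation.EqvGen.trans x y z h1 h2

omit [DecidableEq D] in
/-- Darts of `S` at the same vertex are connected. -/
theorem conn_of_sameCycle {σ α : Perm D} {S : Finset D} {x y : D} (hx : x ∈ S) (hy : y ∈ S)
    (h : σ.SameCycle x y) : conn σ α S x y :=
  Relation.EqvGen.rel x y ⟨hx, hy, Or.inl h⟩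

omit [DecidableEq D] in
/-- The two darts of an edge of `S` are connected. -/
theorem conn_alpha {σ α : Perm D} {S : Finset D} (hS : IsClosed α S) {x : D} (hx : x ∈ S) :
    conn σ α S x (α x) :=
  Relation.EqvGen.rel x (α x) ⟨hx, hS x hx, Or.inr rfl⟩

/-- **At most as many components as vertices.** -/
theorem numK_le_numV (σ α : Perm D) (S : Finset D) : numK σ α S ≤ numV σ S :=
  numClasses_le_of_imp (fun x _ => Equiv.Perm.SameCycle.refl σ x) (fun _ _ _ _ h => conn_symm h)
    (fun _ _ _ _ _ _ h1 h2 => conn_trans h1 h2) (fun _ hx _ hy h => conn_of_sameCycle hx hy h)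

/-! ## The face permutation, faces, and the Euler characteristic -/

section Faces

variable [Fintype D]

/-- **The face permutation** of the dart subset `S`: `φ_S = σ_S ∘ α` — cross the edge, then turn to
the next dart of `S` at the new vertex (`induce σ S`, the induced rotation). Its cycles on `S` are
the faces of the sub-rotation-system. -/
noncomputable def phi (σ α : Perm D) (S : Finset D) : Perm D :=
  induce σ S * α

/-- Unfolding `phi`. -/
theorem phi_apply (σ α : Perm D) (S : Finset D) (x : D) : phi σ α S x = induce σ S (α x) :=
  Perm.mul_apply _ _ _

/-- The face permutation maps `S` to `S` (for `α`-closed `S`). -/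
theorem phi_apply_mem {σ α : Perm D} {S : Finset D} (hS : IsClosed α S) {x : D} (hx : x ∈ S) :
    phi σ α S x ∈ S := by
  rw [phi_apply]
  exact induce_apply_mem σ (hS x hx)

/-- Membership in an `α`-closed `S` is invariant under the face permutation. -/
theorem phi_apply_mem_iff {σ α : Perm D} (h : IsRotSys σ α) {S : Finset D} (hS : IsClosed α S)
    (x : D) : phi σ α S x ∈ S ↔ x ∈ S := by
  refine ⟨fun hm => ?_, phi_apply_mem hS⟩
  rw [phi_apply, induce_apply_mem_iff] at hm
  have := hS _ hm
  rwa [h.α_inv] at this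

/-- Powers of the face permutation keep `S`. -/
theorem phi_pow_apply_mem {σ α : Perm D} {S : Finset D} (hS : IsClosed α S) {x : D} (hx : x ∈ S)
    (k : ℕ) : (phi σ α S ^ k) x ∈ S := by
  induction k with
  | zero => simpa using hx
  | succ k ih => rw [pow_succ', Perm.mul_apply]; exact phi_apply_mem hS ih

/-- **No face of length one**: the face permutation of a loopless rotation system has no fixed
point (on `S` the successor lies at the OTHER end-vertex of the edge; off `S` it is `α x ≠ x`). -/
theorem IsRotSys.phi_ne_self {σ α : Perm D} (h : IsRotSys σ α) (S : Finset D) (x : D) :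
    phi σ α S x ≠ x := by
  intro hfix
  rw [phi_apply] at hfix
  have hsc : σ.SameCycle (α x) (induce σ S (α x)) := sameCycle_induce_apply σ S (α x)
  rw [hfix] at hsc
  have : σ.SameCycle (α x) (α (α x)) := by rw [h.α_inv]; exact hsc
  exact h.loopless (α x) this

/-- **Faces of `S`**: the cycles of the face permutation `φ_S` on `S`. -/
noncomputable def numF (σ α : Perm D) (S : Finset D) : ℕ :=
  numClasses (fun x y => (phi σ α S).SameCycle x y) S

/-- **Twice the Euler characteristic** of the sub-rotation-system `S`:
`2V − #S + 2F` (`#S = 2E`). -/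
noncomputable def chi2 (σ α : Perm D) (S : Finset D) : ℤ :=
  2 * (numV σ S : ℤ) - S.card + 2 * (numF σ α S : ℤ)

/-- `chi2 ∅ = 0`. -/
theorem chi2_empty (σ α : Perm D) : chi2 σ α (∅ : Finset D) = 0 := by
  unfold chi2 numV numF
  rw [numClasses_empty, numClasses_empty]
  simp

/-- The face count is at most the number of darts. -/
theorem numF_le_card (σ α : Perm D) (S : Finset D) : numF σ α S ≤ S.card :=
  numClasses_le_card _ _

/-- **Consecutive darts of a face are connected**: `x ~ φ_S x` (cross the edge, stay at the
vertex). -/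
theorem conn_phi {σ α : Perm D} {S : Finset D} (hS : IsClosed α S) {x : D} (hx : x ∈ S) :
    conn σ α S x (phi σ α S x) := by
  rw [phi_apply]
  exact conn_trans (conn_alpha hS hx)
    (conn_of_sameCycle (hS x hx) (induce_apply_mem σ (hS x hx)) (sameCycle_induce_apply σ S (α x)))

/-- **A face lies inside one component**: darts on a common `φ_S`-cycle are connected. -/
theorem conn_of_sameCycle_phi {σ α : Perm D} {S : Finset D} (hS : IsClosed α S) {x y : D}
    (hx : x ∈ S) (h : (phi σ α S).SameCycle x y) : conn σ α S x y := by
  obtain ⟨k, hk⟩ := h.exists_nat_pow_eq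
  rw [← hk]
  clear hk
  induction k with
  | zero => simpa using conn_refl σ α S x
  | succ k ih =>
    rw [pow_succ', Perm.mul_apply]
    exact conn_trans ih (conn_phi hS (phi_pow_apply_mem hS hx k))

/-- **At most as many components as faces** (for `α`-closed `S`). -/
theorem numK_le_numF {σ α : Perm D} {S : Finset D} (hS : IsClosed α S) :
    numK σ α S ≤ numF σ α S :=
  numClasses_le_of_imp (fun x _ => Equiv.Perm.SameCycle.refl _ x) (fun _ _ _ _ h => conn_symm h)
    (fun _ _ _ _ _ _ h1 h2 => conn_trans h1 h2) (fun _ hx _ _ h => conn_of_sameCycle_phi hS hx h)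

end Faces

end RotSys

end Summit.Ventures.Crystal3D
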